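import Summits.Ventures.Crystal3D.Theorems.StickyWulffConstantCoaxialWallLawReachCoreOfRowsA
import Summits.Ventures.Crystal3D.Theorems.StickyWulffConstantCoaxialWallLawPayerTransPlaneRowAWith
import Summits.Ventures.Crystal3D.Theorems.StickyWulffConstantCoaxialWallLawPayerTwinTwoPlateRowAWith
import HarnessLib

/-!
# The reach core from the two (A) census rows — IN THE EXPLICIT-CONSTANT CURRENCY `CoaxialTwoSlabAdhesionOnWith K 10 S`

HONEST FRAMING. Venture `Summits/Ventures/Crystal3D` (cell `crystal3d-full`), helper `--supports` the crux
`CoaxialWallLaw` of `route-Ventures-StickyWulffConstant` (REGISTERED line `WallLedgerF`).  Rung credit; F-C1 not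
moved; CONDITIONAL on named facts (`KissingGap δ`, `KissingClassification δ`, the two census rows (A)); nothing about
the crux is claimed.  cf-p1 DECISION (lxvii) (2026-08-29T00:13:52Z): restatement programme for lane F's uniformity
debt F-U (`∃ C, CoaxialTwoSlabAdhesionUnifAt C 10`, thickness `R₀ := 10` fixed by T, DECISION (lxvii)(1)), ROW CONE
(owner 19481-p1).  This file is `…ReachCoreOfRowsA` in the currency `CoaxialTwoSlabAdhesionOnWith K 10 S` of
`…CoaxialWallLawLedgerWithDefs`, on the explicit-constant leaves `coaxialTwoSlabAdhesion_trans_skew_rowA_with`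
(`…PayerTransPlaneRowAWith`) and `coaxialTwoSlabAdhesion_general_twin_of_rowA_with` (`…PayerTwinTwoPlateRowAWith`);
the constant `K` depends on the version, `δ` and `s_F` only — NOT on the pair:

* `coaxialTwoSlabAdhesionOnWith_reachTranslation_of_rowA` : `EndRowTransA ver s_F → ∃ K, …OnWith K 10 (ReachPair ∧ Λ₂ = Λ₁)`;
* `coaxialTwoSlabAdhesionOnWith_twin_of_halfTurnRowA` : `EndRowTwinHalfTurnA ver s_F → ∃ K, …OnWith K 10 (Λ₁ ≠ Λ₂)`
  (ALL twin pairs, reach-registered or not);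
* **`coaxialTwoSlabAdhesionOnWith_reach_of_twoRowsA`** : both rows `→ ∃ K, CoaxialTwoSlabAdhesionOnWith K 10 ReachPair`
  — the row cone's interface with the reach-cone assembly (wulff-p2: off-reach pairs in the same currency ⇒
  `∃ C, CoaxialTwoSlabAdhesionUnifAt C 10`);
* `coaxialTwoSlabAdhesionOnWith_reachOrTwin_of_twoRowsA` : the rows' full content `ReachPair ∨ Λ₁ ≠ Λ₂` at one `K`;
* `reachDebtsWith_of_twoRowsA` : R1/R2/R3 in the same currency (by monotonicity).  (Nothing is lost: the existential
  reach core is `coaxialTwoSlabAdhesionOn_of_onWith (by norm_num)` of the above — it IS `coaxialTwoSlabAdhesionReach_of_twoRowsA`.)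
WHAT THIS IS NOT: the rows themselves (census / certificate facts, cf-p2 / lit); not F-U (the off-reach complement is the
reach cone's); F-C1 not moved.
-/

noncomputable section

namespace Summit.Ventures.Crystal3D.Theorems

open Summit.Ventures.Crystal3D Finset NearIdentity
open Summit.Ventures.Crystal3D.Cruxes.CoaxialWallLaw.WallLedgerF (CoaxialTwoSlabAdhesion)
open Literature.MathematicalPhysics.StatisticalMechanics (fccStacking barlowStacking IsHaggSeq constHagg
  isHaggSeq_const contactDeficiency)
open scoped InnerProductSpace

/-- `½·√x ≤ (√6/s_F)·√x` for `0 < s_F ≤ 2√6`. -/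
theorem half_mul_sqrt_le_sqrt_six_div_mul {sF : ℝ} (hsF : 0 < sF) (hsF' : sF ≤ 2 * Real.sqrt 6) (x : ℝ) :
    (1 / 2 : ℝ) * Real.sqrt x ≤ Real.sqrt 6 / sF * Real.sqrt x := by
  refine mul_le_mul_of_nonneg_right ?_ (Real.sqrt_nonneg _)
  rw [le_div_iff₀ hsF]
  linarith only [hsF']

section Rows

variable (ver : WordVersion) {δ : ℝ} (hg : KissingGap δ) (hc : KissingClassification δ)
variable {sF : ℝ} (hsF : 0 < sF) (hsF' : sF ≤ 2 * Real.sqrt 6)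

include hg hc hsF hsF'

open scoped Classical in
/-- **Reach-registered TRANSLATION pairs from the in-plane translation row, explicit constant** (class (C)): one `K`
for all of them, `CoaxialTwoSlabAdhesionOnWith K 10 (ReachPair ∧ Λ₂ = Λ₁)`. -/
theorem coaxialTwoSlabAdhesionOnWith_reachTranslation_of_rowA (hrowT : EndRowTransA ver sF) :
    ∃ K : ℝ, CoaxialTwoSlabAdhesionOnWith K 10 fun A₁ t₁ A₂ t₂ =>
      ReachPair A₁ t₁ A₂ t₂ ∧ A₂ '' fccStacking 1 (Real.sqrt (2 / 3)) = A₁ '' fccStacking 1 (Real.sqrt (2 / 3)) := by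
  obtain ⟨K, hK⟩ := coaxialTwoSlabAdhesion_trans_skew_rowA_with ver hg hc hsF
  refine ⟨K, ?_⟩
  intro A₁ t₁ A₂ t₂ _ hne hS
  obtain ⟨hR, hΛ₂⟩ := hS
  have htrans : A₁ '' fccStacking 1 (Real.sqrt (2 / 3)) = A₂ '' fccStacking 1 (Real.sqrt (2 / 3)) := hΛ₂.symm
  set e₃ : EuclideanSpace ℝ (Fin 3) := EuclideanSpace.single (2 : Fin 3) (1 : ℝ) with he₃
  set τ : EuclideanSpace ℝ (Fin 3) := A₁.symm (t₂ - t₁) with hτ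
  have hτΛ : τ ∉ fccStacking 1 (Real.sqrt (2 / 3)) := offset_notMem_of_ne A₁ A₂ t₁ t₂ htrans hne
  obtain ⟨c, hcube⟩ := cube_of_reach_translation A₁ t₁ A₂ t₂ hR hΛ₂ hτΛ
  obtain ⟨L', hL', hskew⟩ := exists_skewFrame_of_cube A₁ τ c hcube
  have hmain := hK A₁ t₁ A₂ t₂ L' hL' htrans hskew (hrowT L')
  exact ⟨L', t₁, t₂, constHagg, constHagg, isHaggSeq_const, isHaggSeq_const,
    movedFcc_subset_frame_of_image_eq A₁ L' t₁ hL'.symm,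
    movedFcc_subset_frame_of_image_eq A₂ L' t₂ (hΛ₂.trans hL'.symm),
    twoSlabLedgerWith_anti (half_mul_sqrt_le_sqrt_six_div_mul hsF hsF' _) hmain⟩

open scoped Classical in
/-- **ALL twin pairs (`A₁·Λ₀ ≠ A₂·Λ₀`) from the twin half-turn row, explicit constant**: one `K` for all of them,
`CoaxialTwoSlabAdhesionOnWith K 10 (Λ₁ ≠ Λ₂)`. -/
theorem coaxialTwoSlabAdhesionOnWith_twin_of_halfTurnRowA (hrowW : EndRowTwinHalfTurnA ver sF) :
    ∃ K : ℝ, CoaxialTwoSlabAdhesionOnWith K 10 fun A₁ _ A₂ _ =>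
      A₁ '' fccStacking 1 (Real.sqrt (2 / 3)) ≠ A₂ '' fccStacking 1 (Real.sqrt (2 / 3)) := by
  obtain ⟨K, hK⟩ := coaxialTwoSlabAdhesion_general_twin_of_rowA_with ver hg hc hsF hsF'
  refine ⟨K, ?_⟩
  intro A₁ t₁ A₂ t₂ hcoax _ htwin
  obtain ⟨L, s₁, s₂, σ, σ', hσ, hσ', hsub₁, hsub₂⟩ := hcoax
  set e₃ : EuclideanSpace ℝ (Fin 3) := EuclideanSpace.single (2 : Fin 3) (1 : ℝ) with he₃
  have hRR : ∀ L' : EuclideanSpace ℝ (Fin 3) ≃ₗᵢ[ℝ] EuclideanSpace ℝ (Fin 3),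
      ((ℝ ∙ e₃).reflection).trans (((ℝ ∙ e₃).reflection).trans L') = L' := fun L' =>
    LinearIsometryEquiv.ext fun x => by
      simp only [LinearIsometryEquiv.trans_apply, Submodule.reflection_reflection]
  have hrow : ∀ F : Bool → (EuclideanSpace ℝ (Fin 3) ≃ₗᵢ[ℝ] EuclideanSpace ℝ (Fin 3)),
      (F false = L ∧ F true = ((ℝ ∙ e₃).reflection).trans L ∨
        F false = ((ℝ ∙ e₃).reflection).trans L ∧ F true = L) →
      LocalEndRowA ver sF ⟨F false, inPlaneRoots (F false) 1⟩ ⟨F true, inPlaneRoots (F true) (-1)⟩ := by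
    rintro F (⟨h0, h1⟩ | ⟨h0, h1⟩)
    · rw [h0, h1]; exact hrowW L
    · have := hrowW (((ℝ ∙ e₃).reflection).trans L)
      rw [hRR] at this
      rw [h0, h1]; exact this
  exact ⟨L, s₁, s₂, σ, σ', hσ, hσ', hsub₁, hsub₂,
    hK A₁ t₁ A₂ t₂ L s₁ s₂ σ σ' hσ hσ' hsub₁ hsub₂ htwin hrow⟩

/-- **THE REACH CORE FROM THE TWO CENSUS ROWS, explicit constant**: one `K` with
`CoaxialTwoSlabAdhesionOnWith K 10 ReachPair`.  The row cone's interface with the reach-cone assembly. -/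
theorem coaxialTwoSlabAdhesionOnWith_reach_of_twoRowsA (hrowW : EndRowTwinHalfTurnA ver sF)
    (hrowT : EndRowTransA ver sF) : ∃ K : ℝ, CoaxialTwoSlabAdhesionOnWith K 10 ReachPair := by
  obtain ⟨K₁, h₁⟩ := coaxialTwoSlabAdhesionOnWith_reachTranslation_of_rowA ver hg hc hsF hsF' hrowT
  obtain ⟨K₂, h₂⟩ := coaxialTwoSlabAdhesionOnWith_twin_of_halfTurnRowA ver hg hc hsF hsF' hrowW
  refine ⟨max K₁ K₂, coaxialTwoSlabAdhesionOnWith_split_max (by norm_num)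
    (fun A₁ _ A₂ _ => A₂ '' fccStacking 1 (Real.sqrt (2 / 3)) = A₁ '' fccStacking 1 (Real.sqrt (2 / 3))) h₁ ?_⟩
  exact coaxialTwoSlabAdhesionOnWith_mono (fun _ _ _ _ hS => fun h => hS.2 h.symm) h₂

/-- **The rows' full content at one constant**: reach pairs OR twin pairs. -/
theorem coaxialTwoSlabAdhesionOnWith_reachOrTwin_of_twoRowsA (hrowW : EndRowTwinHalfTurnA ver sF)
    (hrowT : EndRowTransA ver sF) : ∃ K : ℝ, CoaxialTwoSlabAdhesionOnWith K 10 fun A₁ t₁ A₂ t₂ =>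
      ReachPair A₁ t₁ A₂ t₂ ∨ A₁ '' fccStacking 1 (Real.sqrt (2 / 3)) ≠ A₂ '' fccStacking 1 (Real.sqrt (2 / 3)) := by
  obtain ⟨K₁, h₁⟩ := coaxialTwoSlabAdhesionOnWith_reachTranslation_of_rowA ver hg hc hsF hsF' hrowT
  obtain ⟨K₂, h₂⟩ := coaxialTwoSlabAdhesionOnWith_twin_of_halfTurnRowA ver hg hc hsF hsF' hrowW
  refine ⟨max K₂ K₁, coaxialTwoSlabAdhesionOnWith_split_max (by norm_num)
    (fun A₁ _ A₂ _ => A₁ '' fccStacking 1 (Real.sqrt (2 / 3)) ≠ A₂ '' fccStacking 1 (Real.sqrt (2 / 3))) ?_ ?_⟩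
  · exact coaxialTwoSlabAdhesionOnWith_mono (fun _ _ _ _ hS => hS.2) h₂
  · refine coaxialTwoSlabAdhesionOnWith_mono (fun A₁ t₁ A₂ t₂ hS => ?_) h₁
    have heq : A₁ '' fccStacking 1 (Real.sqrt (2 / 3)) = A₂ '' fccStacking 1 (Real.sqrt (2 / 3)) := not_not.1 hS.2
    exact ⟨hS.1.resolve_right (not_not.2 heq), heq.symm⟩

/-- **R1, R2, R3 in the explicit-constant currency** (by monotonicity from the reach core). -/
theorem reachDebtsWith_of_twoRowsA (hrowW : EndRowTwinHalfTurnA ver sF) (hrowT : EndRowTransA ver sF) :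
    ∃ K : ℝ, (CoaxialTwoSlabAdhesionOnWith K 10 fun A₁ t₁ A₂ t₂ => ReachPair A₁ t₁ A₂ t₂ ∧ CoherentTwinPair A₁ t₁ A₂ t₂) ∧
      (CoaxialTwoSlabAdhesionOnWith K 10 fun A₁ t₁ A₂ t₂ =>
        (ReachPair A₁ t₁ A₂ t₂ ∧ ¬ CoherentTwinPair A₁ t₁ A₂ t₂) ∧ CoherentFaultPair A₁ t₁ A₂ t₂) ∧
      (CoaxialTwoSlabAdhesionOnWith K 10 fun A₁ t₁ A₂ t₂ =>
        ((ReachPair A₁ t₁ A₂ t₂ ∧ ¬ CoherentTwinPair A₁ t₁ A₂ t₂) ∧ ¬ CoherentFaultPair A₁ t₁ A₂ t₂) ∧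
          DeepPair A₁ t₁ A₂ t₂) := by
  obtain ⟨K, h⟩ := coaxialTwoSlabAdhesionOnWith_reach_of_twoRowsA ver hg hc hsF hsF' hrowW hrowT
  exact ⟨K, coaxialTwoSlabAdhesionOnWith_mono (fun _ _ _ _ hT => hT.1) h,
    coaxialTwoSlabAdhesionOnWith_mono (fun _ _ _ _ hT => hT.1.1) h,
    coaxialTwoSlabAdhesionOnWith_mono (fun _ _ _ _ hT => hT.1.1.1) h⟩

end Rows

end Summit.Ventures.Crystal3D.Theorems

end
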